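import Summits.CriticalPhenomena.PercolationContinuityZ3.Theorems.PercNearOneGluingNoHeavyLowerTailSahiGridPatternTwoChartSharp
import Summits.CriticalPhenomena.PercolationContinuityZ3.Theorems.PercNearOneGluingNoHeavyLowerTailSahiGridPatternTopCube

/-!
# `NoHeavyLowerTail` (crux stmt-CriticalPhenomena-4575), Sahi programme P1: **CB⁺ ON EVERY TOP CUBE** — the sharpened witness-sum
# inequality `Σ_{u∈U} Σ_T (1_X(u^T) − 1_{X'}(u))(1_Y(u^{Tᶜ}) − 1_{Y'}(u)) ≥ 2^k·#(U ∩ (X'∖X) ∩ (Y'∖Y))` for up-sets `U ⊆ {1,2}^k`, `X ⊆ X'`, `Y ⊆ Y'`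

Support file (Sahi cell, seat `prim-sahi-p1`, generation 31; `--supports stmt-CriticalPhenomena-4575`).  Pure proofs, NO definitions, no
`sorry`, standard axioms.  Vocabulary of `…SahiGridPattern{,TopCube,TwoChartSharp}` (`fromSet u T` = the chart point `u^T`; `ind`).

THE MATHEMATICS.  Generation 19 proved CONJECTURE B — `G(U;B,C) = Σ_{u∈U} Σ_T (1_B(u^T) − 1_B(u))(1_C(u^{Tᶜ}) − 1_C(u)) ≥ 0` for every
up-set `U` inside the top cube `{1,2}^k` — chart pair by chart pair from the two-chart transport lemma.  Generation 30 (memo §3.3–3.4)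
reduced CONJECTURE D (diagonal routing of every top-cube up-set `S`, all `j, k`; kernel theorem for `j ≤ 3`) to the S-block inequality
CB⁺, whose witness form is the present theorem with TWO NESTED PAIRS of up-sets `X ⊆ X'`, `Y ⊆ Y'` (corners from the small sets, centres
from the large ones):
  **`2^k · #(U ∩ (X'∖X) ∩ (Y'∖Y)) ≤ Σ_{u∈U} Σ_{T ⊆ [k]} (1_X(u^T) − 1_{X'}(u))·(1_Y(u^{Tᶜ}) − 1_{Y'}(u))`**  (`topCube_witnessSum_sharp`),
obtained exactly as in `…TopCube` from the SHARPENED two-chart lemma `twoChart_sum_sharp_sumForm` (generation 31): each chart pair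
`{T, Tᶜ}` contributes `≥ 2·#(U ∩ (X'∖X) ∩ (Y'∖Y))` (`chartPair_sum_sharp`).  For `X = X'`, `Y = Y'` this is `sStarD_topCube_ge_harris`
again.  Nothing here asserts `PatternPos d` for any `d ≥ 4`. [this work]
-/

namespace Summit.CriticalPhenomena.PercolationContinuityZ3.Theorems.SahiGridPattern

open Finset SahiGrid3
open scoped BigOperators

variable {k : ℕ}

/-- Inflation is monotone in the set: `X ⊆ X'` gives inflate `X ⊆` inflate `X'`. [this work] -/
theorem inflate_mono (T : Finset (Fin k)) {W W' : Finset (Pd k)} (h : W ⊆ W') :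
    (univ.filter fun p : Finset (Fin k) × Finset (Fin k) => fromSet (0 : Pd k) ((p.1 ∩ T) ∪ (p.2 ∩ Tᶜ)) ∈ W) ⊆
      (univ.filter fun p : Finset (Fin k) × Finset (Fin k) => fromSet (0 : Pd k) ((p.1 ∩ T) ∪ (p.2 ∩ Tᶜ)) ∈ W') := by
  intro p hp
  rw [Finset.mem_filter] at hp ⊢
  exact ⟨hp.1, h hp.2⟩

/-- **The inflated sharpened chart-pair sum is nonnegative** (the sharpened two-chart lemma applied to the chart `T`, corners and arms from
the small sets `X, Y`, centres from `X', Y'`). [this work] -/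
theorem inflated_sum_sharp (T : Finset (Fin k)) {U X X' Y Y' : Finset (Pd k)} (hU : IsUpperSet (U : Set (Pd k)))
    (hX : IsUpperSet (X : Set (Pd k))) (hX' : IsUpperSet (X' : Set (Pd k)))
    (hY : IsUpperSet (Y : Set (Pd k))) (hY' : IsUpperSet (Y' : Set (Pd k))) (hXX' : X ⊆ X') (hYY' : Y ⊆ Y') :
    0 ≤ ∑ p ∈ (univ.filter fun p : Finset (Fin k) × Finset (Fin k) => fromSet (0 : Pd k) ((p.1 ∩ T) ∪ (p.2 ∩ Tᶜ)) ∈ U),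
      ((ind X (fromSet (fromSet (0 : Pd k) ((p.1 ∩ T) ∪ (p.2 ∩ Tᶜ))) T) - ind X' (fromSet (0 : Pd k) ((p.1 ∩ T) ∪ (p.2 ∩ Tᶜ))))
        * (ind Y (fromSet (fromSet (0 : Pd k) ((p.1 ∩ T) ∪ (p.2 ∩ Tᶜ))) Tᶜ) - ind Y' (fromSet (0 : Pd k) ((p.1 ∩ T) ∪ (p.2 ∩ Tᶜ))))
      + (ind X (fromSet (fromSet (0 : Pd k) ((p.1 ∩ T) ∪ (p.2 ∩ Tᶜ))) Tᶜ) - ind X' (fromSet (0 : Pd k) ((p.1 ∩ T) ∪ (p.2 ∩ Tᶜ))))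
        * (ind Y (fromSet (fromSet (0 : Pd k) ((p.1 ∩ T) ∪ (p.2 ∩ Tᶜ))) T) - ind Y' (fromSet (0 : Pd k) ((p.1 ∩ T) ∪ (p.2 ∩ Tᶜ))))
      - 2 * ((ind X' (fromSet (0 : Pd k) ((p.1 ∩ T) ∪ (p.2 ∩ Tᶜ))) - ind X (fromSet (0 : Pd k) ((p.1 ∩ T) ∪ (p.2 ∩ Tᶜ))))
        * (ind Y' (fromSet (0 : Pd k) ((p.1 ∩ T) ∪ (p.2 ∩ Tᶜ))) - ind Y (fromSet (0 : Pd k) ((p.1 ∩ T) ∪ (p.2 ∩ Tᶜ)))))) := by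
  have h := twoChart_sum_sharp_sumForm
    (univ.filter fun p : Finset (Fin k) × Finset (Fin k) => fromSet (0 : Pd k) ((p.1 ∩ T) ∪ (p.2 ∩ Tᶜ)) ∈ U)
    (univ.filter fun p : Finset (Fin k) × Finset (Fin k) => fromSet (0 : Pd k) ((p.1 ∩ T) ∪ (p.2 ∩ Tᶜ)) ∈ X)
    (univ.filter fun p : Finset (Fin k) × Finset (Fin k) => fromSet (0 : Pd k) ((p.1 ∩ T) ∪ (p.2 ∩ Tᶜ)) ∈ Y)
    (univ.filter fun p : Finset (Fin k) × Finset (Fin k) => fromSet (0 : Pd k) ((p.1 ∩ T) ∪ (p.2 ∩ Tᶜ)) ∈ X')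
    (univ.filter fun p : Finset (Fin k) × Finset (Fin k) => fromSet (0 : Pd k) ((p.1 ∩ T) ∪ (p.2 ∩ Tᶜ)) ∈ Y')
    (isUpperSet_inflate T hU) (isUpperSet_inflate T hX) (isUpperSet_inflate T hY) (isUpperSet_inflate T hX') (isUpperSet_inflate T hY')
    (inflate_mono T hXX') (inflate_mono T hYY')
    (univ.filter fun S : Finset (Fin k) => fromSet (0 : Pd k) (S ∩ T) ∈ X)
    (univ.filter fun S : Finset (Fin k) => fromSet (0 : Pd k) (S ∩ T) ∈ Y)
    (univ.filter fun S : Finset (Fin k) => fromSet (fromSet (0 : Pd k) S) T ∈ X)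
    (univ.filter fun S : Finset (Fin k) => fromSet (fromSet (0 : Pd k) S) T ∈ Y)
    (univ.filter fun S : Finset (Fin k) => fromSet (0 : Pd k) (S ∩ Tᶜ) ∈ X)
    (univ.filter fun S : Finset (Fin k) => fromSet (0 : Pd k) (S ∩ Tᶜ) ∈ Y)
    (univ.filter fun S : Finset (Fin k) => fromSet (fromSet (0 : Pd k) S) Tᶜ ∈ Y)
    (univ.filter fun S : Finset (Fin k) => fromSet (fromSet (0 : Pd k) S) Tᶜ ∈ X)
    (arm_fst_mem T hX) (arm_snd_mem T hX) (arm_fst_mem T hY) (arm_snd_mem T hY)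
    (hk_chart T hX) (hk_chart T hY) (hk_chart Tᶜ hY) (hk_chart Tᶜ hX)
  refine le_trans h (le_of_eq (Finset.sum_congr rfl fun p _ => ?_))
  rw [ind_corner_fst T X p, ind_corner_fst T Y p, ind_corner_snd T X p, ind_corner_snd T Y p, ind_inflate T X p, ind_inflate T Y p,
    ind_inflate T X' p, ind_inflate T Y' p]

/-- **THE SHARPENED CHART-PAIR INEQUALITY** (every `k`, every chart `T`): for an up-set `U` inside the top cube and up-sets `X ⊆ X'`,
`Y ⊆ Y'`, `Σ_{u∈U} [(1_X(u^T) − 1_{X'}(u))(1_Y(u^{Tᶜ}) − 1_{Y'}(u)) + (1_X(u^{Tᶜ}) − 1_{X'}(u))(1_Y(u^T) − 1_{Y'}(u))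
− 2(1_{X'}(u) − 1_X(u))(1_{Y'}(u) − 1_Y(u))] ≥ 0`. [this work] -/
theorem chartPair_sum_sharp (T : Finset (Fin k)) {U X X' Y Y' : Finset (Pd k)} (hU : IsUpperSet (U : Set (Pd k)))
    (htop : ∀ u ∈ U, ∀ a, u a ≠ 0) (hX : IsUpperSet (X : Set (Pd k))) (hX' : IsUpperSet (X' : Set (Pd k)))
    (hY : IsUpperSet (Y : Set (Pd k))) (hY' : IsUpperSet (Y' : Set (Pd k))) (hXX' : X ⊆ X') (hYY' : Y ⊆ Y') :
    0 ≤ ∑ u ∈ U, ((ind X (fromSet u T) - ind X' u) * (ind Y (fromSet u Tᶜ) - ind Y' u)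
      + (ind X (fromSet u Tᶜ) - ind X' u) * (ind Y (fromSet u T) - ind Y' u)
      - 2 * ((ind X' u - ind X u) * (ind Y' u - ind Y u))) := by
  set g : Finset (Fin k) → ℤ := fun S => if fromSet (0 : Pd k) S ∈ U then
      ((ind X (fromSet (fromSet (0 : Pd k) S) T) - ind X' (fromSet (0 : Pd k) S))
          * (ind Y (fromSet (fromSet (0 : Pd k) S) Tᶜ) - ind Y' (fromSet (0 : Pd k) S))
        + (ind X (fromSet (fromSet (0 : Pd k) S) Tᶜ) - ind X' (fromSet (0 : Pd k) S))
          * (ind Y (fromSet (fromSet (0 : Pd k) S) T) - ind Y' (fromSet (0 : Pd k) S))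
        - 2 * ((ind X' (fromSet (0 : Pd k) S) - ind X (fromSet (0 : Pd k) S))
          * (ind Y' (fromSet (0 : Pd k) S) - ind Y (fromSet (0 : Pd k) S)))) else 0 with hg
  have h1 : 0 ≤ ∑ p : Finset (Fin k) × Finset (Fin k), g ((p.1 ∩ T) ∪ (p.2 ∩ Tᶜ)) := by
    have h := inflated_sum_sharp T hU hX hX' hY hY' hXX' hYY'
    rw [Finset.sum_filter] at h
    refine le_trans h (le_of_eq (Finset.sum_congr rfl fun p _ => ?_))
    simp only [hg]
  have h2 : (∑ p : Finset (Fin k) × Finset (Fin k), g ((p.1 ∩ T) ∪ (p.2 ∩ Tᶜ)))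
      = ∑ p : Finset (Fin k) × Finset (Fin k), g p.1 :=
    Equiv.sum_comp (Function.Involutive.toPerm _ (recomb_involutive T)) (fun q : Finset (Fin k) × Finset (Fin k) => g q.1)
  have h3 : (∑ p : Finset (Fin k) × Finset (Fin k), g p.1) = (Fintype.card (Finset (Fin k)) : ℤ) * ∑ S : Finset (Fin k), g S := by
    rw [Fintype.sum_prod_type, Finset.mul_sum]
    refine Finset.sum_congr rfl fun S _ => ?_
    show (∑ _Y : Finset (Fin k), g S) = _
    rw [Finset.sum_const, Finset.card_univ, nsmul_eq_mul]
  have h4 : (∑ S : Finset (Fin k), g S) = ∑ u ∈ U, ((ind X (fromSet u T) - ind X' u) * (ind Y (fromSet u Tᶜ) - ind Y' u)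
      + (ind X (fromSet u Tᶜ) - ind X' u) * (ind Y (fromSet u T) - ind Y' u)
      - 2 * ((ind X' u - ind X u) * (ind Y' u - ind Y u))) := by
    have e : (∑ S : Finset (Fin k), g S) = ∑ S ∈ univ.filter (fun S : Finset (Fin k) => fromSet (0 : Pd k) S ∈ U),
        ((ind X (fromSet (fromSet (0 : Pd k) S) T) - ind X' (fromSet (0 : Pd k) S))
            * (ind Y (fromSet (fromSet (0 : Pd k) S) Tᶜ) - ind Y' (fromSet (0 : Pd k) S))
          + (ind X (fromSet (fromSet (0 : Pd k) S) Tᶜ) - ind X' (fromSet (0 : Pd k) S))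
            * (ind Y (fromSet (fromSet (0 : Pd k) S) T) - ind Y' (fromSet (0 : Pd k) S))
          - 2 * ((ind X' (fromSet (0 : Pd k) S) - ind X (fromSet (0 : Pd k) S))
            * (ind Y' (fromSet (0 : Pd k) S) - ind Y (fromSet (0 : Pd k) S)))) := by
      rw [Finset.sum_filter]
    rw [e]
    refine Finset.sum_nbij' (fun S => fromSet (0 : Pd k) S) (fun u => toSet (0 : Pd k) u) (fun S hS => ?_) (fun u hu => ?_)
      (fun S _ => toSet_fromSet 0 S) (fun u hu => fromSet_toSet_zero (htop u hu)) (fun S _ => rfl)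
    · rw [Finset.mem_filter] at hS; exact hS.2
    · rw [Finset.mem_filter]; exact ⟨mem_univ _, by rw [fromSet_toSet_zero (htop u hu)]; exact hu⟩
  rw [h2, h3, h4] at h1
  have hpos : (0 : ℤ) < (Fintype.card (Finset (Fin k)) : ℤ) := by exact_mod_cast Fintype.card_pos
  exact le_of_mul_le_mul_left (by rw [mul_zero]; exact h1) hpos

/-- **CB⁺ ON EVERY TOP CUBE (witness form)** — the sharpened Conjecture B, every dimension `k`: for an up-set `U ⊆ [3]^k` all of whose
points have no zero coordinate and up-sets `X ⊆ X'`, `Y ⊆ Y'`,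
`2^k · Σ_{u∈U} (1_{X'}(u) − 1_X(u))(1_{Y'}(u) − 1_Y(u)) ≤ Σ_{u∈U} Σ_{T ⊆ [k]} (1_X(u^T) − 1_{X'}(u))·(1_Y(u^{Tᶜ}) − 1_{Y'}(u))`;
for `X' = X`, `Y' = Y` this is Conjecture B (`sStarD_topCube_ge_harris`, in the witness form `harrisReduced_eq_sum`). [this work] -/
theorem topCube_witnessSum_sharp (U : Finset (Pd k)) (hU : IsUpperSet (U : Set (Pd k))) (htop : ∀ u ∈ U, ∀ a, u a ≠ 0)
    {X X' Y Y' : Finset (Pd k)} (hX : IsUpperSet (X : Set (Pd k))) (hX' : IsUpperSet (X' : Set (Pd k)))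
    (hY : IsUpperSet (Y : Set (Pd k))) (hY' : IsUpperSet (Y' : Set (Pd k))) (hXX' : X ⊆ X') (hYY' : Y ⊆ Y') :
    2 ^ k * (∑ u ∈ U, (ind X' u - ind X u) * (ind Y' u - ind Y u)) ≤
      ∑ u ∈ U, ∑ T : Finset (Fin k), (ind X (fromSet u T) - ind X' u) * (ind Y (fromSet u Tᶜ) - ind Y' u) := by
  have hswap : (∑ u ∈ U, ∑ T : Finset (Fin k), (ind X (fromSet u T) - ind X' u) * (ind Y (fromSet u Tᶜ) - ind Y' u))
      = ∑ T : Finset (Fin k), ∑ u ∈ U, (ind X (fromSet u T) - ind X' u) * (ind Y (fromSet u Tᶜ) - ind Y' u) := Finset.sum_comm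
  have hcompl : (∑ T : Finset (Fin k), ∑ u ∈ U, (ind X (fromSet u Tᶜ) - ind X' u) * (ind Y (fromSet u T) - ind Y' u))
      = ∑ T : Finset (Fin k), ∑ u ∈ U, (ind X (fromSet u T) - ind X' u) * (ind Y (fromSet u Tᶜ) - ind Y' u) :=
    Fintype.sum_bijective _ compl_bijective _ _ fun T => by simp only [compl_compl]
  have hpair : 0 ≤ ∑ T : Finset (Fin k), ∑ u ∈ U, ((ind X (fromSet u T) - ind X' u) * (ind Y (fromSet u Tᶜ) - ind Y' u)
      + (ind X (fromSet u Tᶜ) - ind X' u) * (ind Y (fromSet u T) - ind Y' u)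
      - 2 * ((ind X' u - ind X u) * (ind Y' u - ind Y u))) :=
    Finset.sum_nonneg fun T _ => chartPair_sum_sharp T hU htop hX hX' hY hY' hXX' hYY'
  have hsplit : (∑ T : Finset (Fin k), ∑ u ∈ U, ((ind X (fromSet u T) - ind X' u) * (ind Y (fromSet u Tᶜ) - ind Y' u)
      + (ind X (fromSet u Tᶜ) - ind X' u) * (ind Y (fromSet u T) - ind Y' u)
      - 2 * ((ind X' u - ind X u) * (ind Y' u - ind Y u))))
      = (∑ T : Finset (Fin k), ∑ u ∈ U, (ind X (fromSet u T) - ind X' u) * (ind Y (fromSet u Tᶜ) - ind Y' u))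
        + (∑ T : Finset (Fin k), ∑ u ∈ U, (ind X (fromSet u Tᶜ) - ind X' u) * (ind Y (fromSet u T) - ind Y' u))
        - ∑ T : Finset (Fin k), ∑ u ∈ U, 2 * ((ind X' u - ind X u) * (ind Y' u - ind Y u)) := by
    rw [← Finset.sum_add_distrib, ← Finset.sum_sub_distrib]
    refine Finset.sum_congr rfl fun T _ => ?_
    rw [← Finset.sum_add_distrib, ← Finset.sum_sub_distrib]
  have hconst : (∑ T : Finset (Fin k), ∑ u ∈ U, 2 * ((ind X' u - ind X u) * (ind Y' u - ind Y u)))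
      = 2 ^ k * (2 * ∑ u ∈ U, (ind X' u - ind X u) * (ind Y' u - ind Y u)) := by
    rw [Finset.sum_const, Finset.card_univ, Fintype.card_finset, Fintype.card_fin, nsmul_eq_mul, ← Finset.mul_sum]
    push_cast
    ring
  rw [hsplit, hcompl, hconst, ← hswap] at hpair
  linarith

end Summit.CriticalPhenomena.PercolationContinuityZ3.Theorems.SahiGridPattern
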